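import Mathlib

/-!
# Crux `FreeSubtorus.OrbitDimensionBound` (stmt-ValiantsHypothesis-16133), line `Sketch` —
# stub `stub_saturationBasis` (the saturation of an integer lattice `ℤΛ ⊆ ℤ^ι` generated by `r`
# vectors has a `ℤ`-basis of at most `r` integer vectors)

Setting: `ι` a finite index type and `Λ : Fin r → ι → ℤ` a family of `r` integer vectors (the
character relations cutting out the subtorus `T_Λ`).  The SATURATION of the lattice `ℤΛ = span_ℤ Λ`
is `Λ_sat = {x ∈ ℤ^ι : c • x ∈ ℤΛ for some integer c ≠ 0}`; only `Λ_sat` is seen by the identity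
component of `T_Λ`.  Conclusion: there are `r' ≤ r` vectors `Λ' : Fin r' → ι → ℤ`, each in `Λ_sat`,
such that every element of `Λ_sat` is an integer combination of them (a `ℤ`-basis of `Λ_sat`).

Proof.  `Λ_sat` is a `ℤ`-submodule `N` of the free finite-rank `ℤ`-module `ι → ℤ` (closed under `+`
by multiplying the two constants, under `a • _` with the same constant), so over the PID `ℤ` it is
free of finite rank: `Submodule.basisOfPid (Pi.basisFun ℤ ι) N` gives a basis `b : Fin r' → N`, and
`Λ' t := b t`.  The vectors `b t` are `ℤ`-independent in `ℤ^ι`; choosing `c_t ≠ 0` with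
`c_t • b t ∈ ℤΛ`, the family `c_t • b t` is still `ℤ`-independent (`ℤ` is a domain, `ℤ^ι` is
torsion free) and lies in `span_ℤ (range Λ)`, which is spanned by at most `r` vectors, so `r' ≤ r`
by the strong rank condition for `ℤ` (`linearIndependent_le_span_aux'`, `Fintype.card_range_le`).
The last conjunct is `Basis.sum_repr` pushed through the coercion `N → ℤ^ι`. [folklore]
-/

-- Sub = Summit single-conjunct layout: the duplicated namespace component is mandated by the tree.
set_option linter.dupNamespace false

namespace Summit.ValiantsHypothesis.ValiantsHypothesis.Theorems.FreeSubtorusOrbitDimensionBound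

open Finset

/-- **Registered stub `stub_saturationBasis`** of line `Sketch` of crux `OrbitDimensionBound`
(modules over a PID).  The saturation `Λ_sat = {x ∈ ℤ^ι : c • x ∈ ℤΛ for some c ≠ 0}` of the
lattice `ℤΛ` generated by `r` integer vectors `Λ i` has a `ℤ`-basis `Λ'` of at most `r` vectors:
`r' ≤ r` vectors `Λ' t ∈ Λ_sat` such that every `x ∈ Λ_sat` is an integer combination
`x = ∑ t, z' t • Λ' t` (`Submodule.basisOfPid`; the basis vectors, scaled into `ℤΛ`, are
`ℤ`-independent inside `span_ℤ Λ`, whence `r' ≤ r` by the strong rank condition). [folklore] -/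
theorem stub_saturationBasis {ι : Type} [Fintype ι] [DecidableEq ι] (r : ℕ) (Λ : Fin r → ι → ℤ) :
    ∃ (r' : ℕ) (Λ' : Fin r' → ι → ℤ), r' ≤ r ∧
      (∀ t, ∃ (c : ℤ) (z : Fin r → ℤ), c ≠ 0 ∧ c • Λ' t = ∑ i, z i • Λ i) ∧
      ∀ x : ι → ℤ, (∃ (c : ℤ) (z : Fin r → ℤ), c ≠ 0 ∧ c • x = ∑ i, z i • Λ i) →
        ∃ z' : Fin r' → ℤ, x = ∑ t, z' t • Λ' t := by
  -- the saturation `Λ_sat` as a `ℤ`-submodule `N` of `ℤ^ι`, with its membership characterisation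
  obtain ⟨N, hN⟩ : ∃ N : Submodule ℤ (ι → ℤ), ∀ x, x ∈ N ↔
      ∃ (c : ℤ) (z : Fin r → ℤ), c ≠ 0 ∧ c • x = ∑ i, z i • Λ i := by
    refine ⟨{ carrier := {x | ∃ c : ℤ, c ≠ 0 ∧ c • x ∈ Submodule.span ℤ (Set.range Λ)}
              add_mem' := by
                rintro x y ⟨c₁, hc₁, h₁⟩ ⟨c₂, hc₂, h₂⟩
                refine ⟨c₁ * c₂, mul_ne_zero hc₁ hc₂, ?_⟩
                rw [smul_add]
                exact Submodule.add_mem _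
                  (by rw [mul_comm, mul_smul]; exact Submodule.smul_mem _ _ h₁)
                  (by rw [mul_smul]; exact Submodule.smul_mem _ _ h₂)
              zero_mem' := ⟨1, one_ne_zero, by rw [smul_zero]; exact Submodule.zero_mem _⟩
              smul_mem' := by
                rintro a x ⟨c, hc, h⟩
                exact ⟨c, hc, by rw [smul_comm]; exact Submodule.smul_mem _ _ h⟩ }, fun x => ?_⟩
    change (∃ c : ℤ, c ≠ 0 ∧ c • x ∈ Submodule.span ℤ (Set.range Λ)) ↔ _
    refine exists_congr fun c => ?_
    rw [Submodule.mem_span_range_iff_exists_fun]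
    exact ⟨fun ⟨hc, z, hz⟩ => ⟨z, hc, hz.symm⟩, fun ⟨z, hc, hz⟩ => ⟨hc, z, hz.symm⟩⟩
  -- `N` is free of finite rank over the PID `ℤ`
  obtain ⟨n, b⟩ := Submodule.basisOfPid (Pi.basisFun ℤ ι) N
  -- the basis vectors, viewed in `ℤ^ι`, are `ℤ`-independent
  have hli : LinearIndependent ℤ fun t => (b t : ι → ℤ) :=
    b.linearIndependent.map' N.subtype (Submodule.ker_subtype _)
  -- each has a nonzero multiple in `ℤΛ`
  choose c z hc hcz using fun t => (hN _).mp (b t).2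
  -- the scaled family is still `ℤ`-independent
  have hli' : LinearIndependent ℤ fun t => c t • (b t : ι → ℤ) := by
    rw [Fintype.linearIndependent_iff] at hli ⊢
    intro g hg t
    have h : g t * c t = 0 := hli (fun t => g t * c t) (by simpa only [mul_smul] using hg) t
    exact (mul_eq_zero.mp h).resolve_right (hc t)
  -- and lies in `span_ℤ (range Λ)`, hence `n ≤ card (range Λ) ≤ r`
  have hn : n ≤ r := by
    have h1 := linearIndependent_le_span_aux' _ hli' (Set.range Λ) (by
      rintro _ ⟨t, rfl⟩
      exact (Submodule.mem_span_range_iff_exists_fun ℤ).mpr ⟨z t, (hcz t).symm⟩)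
    have h2 := Fintype.card_range_le Λ
    simp only [Fintype.card_fin] at h1 h2
    exact h1.trans h2
  refine ⟨n, fun t => (b t : ι → ℤ), hn, fun t => (hN _).mp (b t).2, fun x hx => ?_⟩
  -- every element of `N` is an integer combination of the basis vectors
  have hx' : x ∈ N := (hN x).mpr hx
  refine ⟨fun t => b.repr ⟨x, hx'⟩ t, ?_⟩
  have h := congrArg Subtype.val (b.sum_repr ⟨x, hx'⟩)
  rw [Submodule.coe_sum] at h
  simp only [Submodule.coe_smul] at h
  exact h.symm

end Summit.ValiantsHypothesis.ValiantsHypothesis.Theorems.FreeSubtorusOrbitDimensionBound
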